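import Literature.Combinatorics.StablePolynomials.StabilityPreserversAllDegrees
import Literature.Combinatorics.StablePolynomials.MasterCompositionMultivariate
import HarnessLib

/-!
# The master composition theorem for every `κ ∈ ℕⁿ`, and Corollary 3.4 (b) (Borcea–Brändén II)

J. Borcea, P. Brändén, *The Lee–Yang and Pólya–Schur programs. II. Theory of stable polynomials and
applications*, Comm. Pure Appl. Math. 62 (2009) 1595–1631 (arXiv:0809.3087), §3:

> **Corollary 3.4.** Let `κ ∈ ℕⁿ` and `f, g ∈ ℂ[z_1,…,z_n,w_1,…,w_n]` be of the form
> `f(z,w) = Σ_{α ≤ κ} binom(κ,α) P_α(w) z^α`, `g(z,w) = Σ_{α ≤ κ} binom(κ,α) Q_α(z) w^α`.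
> (a) If `f` and `g` are `H_θ`-stable for some `0 ≤ θ < 2π`, then so is the polynomial
> `Σ_{α ≤ κ} binom(κ,α) P_α(w) Q_{κ-α}(z)` … unless it is identically zero.
> (b) If `f` and `g` are `H_0`-stable, then so is the polynomial `Σ_{α ≤ κ} (-1)^α binom(κ,α) P_α(w) Q_α(z)` …
> unless it is identically zero. …
> *Proof.* … This proves (a). Parts (b) and (c) follow similarly.

Here `H_0 = ℋ` is the open upper half-plane. The tree's `mv_master_composition`
(`MasterCompositionMultivariate.lean`) is part (a) for `H_θ = ℋ` under the restriction `κ_i ≥ 1`, because it was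
built on Borcea–Brändén I, Theorem 1.1 for `κ_i ≥ 1`. §1 of this file reruns the printed proof of (a) verbatim on
Theorem 1.1 for every `κ ∈ ℕⁿ` (tree `BorceaBranden_stabilityPreserver_iff'`, `StabilityPreserversAllDegrees.lean`),
which removes the restriction (`mv_master_composition'`). §2 makes "(b) follows similarly" explicit for `ℋ`: with
`g` also `g̃(z,w) = w^κ g(z,-1/w) = Σ_{α ≤ κ} binom(κ,α) (-1)^{|κ-α|} Q_{κ-α}(z) w^α` is `ℋ`-stable (`-1/w ∈ ℋ` for
`w ∈ ℋ`; `isUpperHalfPlaneStable_mvCompositionG_reflectNeg`), and (a) applied to `f` and `g̃` is exactly the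
polynomial of (b) (`mvComposition_reflectNeg`, `mv_master_composition_b`). Part (c) concerns the unit disk and is
not treated here.

## Contents

* §1 `mv_master_composition_pass'`, **`mv_master_composition'`** (Cor. 3.4 (a) for `ℋ`, every `κ`).
* §2 `eval_mvCompositionG`, `reflectNeg`, `eval_mvCompositionG_reflectNeg`,
  `isUpperHalfPlaneStable_mvCompositionG_reflectNeg`, `mvCompositionB`, `mvComposition_reflectNeg`,
  **`mv_master_composition_b`** (Cor. 3.4 (b), every `κ`).

## References

* [BorceaBranden2009II] J. Borcea, P. Brändén, Comm. Pure Appl. Math. 62 (2009) 1595–1631, §3 Cor. 3.4 (a), (b)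
  and its proof; Thm. 3.3 (a) for the alternative "or identically zero".
* [BorceaBranden2009] J. Borcea, P. Brändén, Invent. Math. 177 (2009) 541–569, §1.1 Thm. 1.1.
-/

noncomputable section

open MvPolynomial Finset

namespace Literature.Combinatorics.StablePolynomials

variable {τ : Type*} [Fintype τ] [DecidableEq τ]

/-! ## §1 Corollary 3.4 (a) for every `κ` -/

section AllKappa

omit [Fintype τ] [DecidableEq τ] in
/-- Substituting constants: `p(C c, …, C c) = C(p(c,…,c))`. [folklore] -/
private theorem aeval_const_C' (c : ℂ) (p : MvPolynomial τ ℂ) :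
    aeval (fun _ : τ => (C c : MvPolynomial τ ℂ)) p = C (eval (fun _ => c) p) := by
  induction p using MvPolynomial.induction_on with
  | C a => rw [aeval_C, eval_C, algebraMap_eq]
  | add p q hp hq => rw [map_add, map_add, hp, hq, map_add]
  | mul_X p i hp => rw [_root_.map_mul, aeval_X, hp, _root_.map_mul, eval_X, _root_.map_mul]

/-- **One pass of the printed argument, every `κ ∈ ℕⁿ`**: if `f` and `g` are stable then `h` is stable, or
`h = A(z)B(w)` with `A` stable (the rank-one alternative of Theorem 1.1 for `ST`). Same proof as the tree's
`mv_master_composition_pass`, with Theorem 1.1 for every `κ` in place of its `κ_i ≥ 1` version.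
[cite: BorceaBranden2009II, §3 proof of Cor. 3.4] [cite: BorceaBranden2009, §1.1 Thm. 1.1] -/
theorem mv_master_composition_pass' {κ : τ → ℕ} (P Q : (τ → ℕ) → MvPolynomial τ ℂ)
    (hf : IsUpperHalfPlaneStable (mvCompositionF κ P)) (hg : IsUpperHalfPlaneStable (mvCompositionG κ Q)) :
    IsUpperHalfPlaneStable (mvComposition κ P Q) ∨
      ∃ A B : MvPolynomial τ ℂ, IsUpperHalfPlaneStable A ∧
        mvComposition κ P Q = rename Sum.inl A * rename Sum.inr B := by
  -- a common degree box `β` for the `P_α` ("`β ∈ ℕⁿ` appropriately chosen")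
  set β : τ → ℕ := fun i => (Fintype.piFinset fun j => range (κ j + 1)).sup fun α => degreeOf i (P α) with hβ
  have hP : ∀ α ∈ Fintype.piFinset (fun j => range (κ j + 1)), ∀ i, degreeOf i (P α) ≤ β i := fun α hα i =>
    Finset.le_sup (f := fun α => degreeOf i (P α)) hα
  -- `S` preserves stability on `ℂ_κ[z]` (its symbol is `g`)
  have hS : ∀ p : MvPolynomial τ ℂ, (∀ i, degreeOf i p ≤ κ i) → IsUpperHalfPlaneStable p →
      IsUpperHalfPlaneStable (mvSlotOp κ Q p) ∨ mvSlotOp κ Q p = 0 :=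
    (BorceaBranden_stabilityPreserver_iff' κ (mvSlotOp κ Q)).2 (Or.inr (by rw [symbol_mvSlotOp]; exact hg))
  -- `T` preserves stability on `ℂ_β[z]` (its symbol is `f`) and maps into `ℂ_κ[z]`
  set T := mvOpOf β κ P fun α => ∏ i, X i ^ α i with hT
  have hTsymb : boundedDegreeSymbol β T = mvCompositionF κ P := by
    rw [hT, symbol_mvOpOf hP, mvCompositionF]
    refine sum_congr rfl fun α _ => ?_
    rw [_root_.map_prod]
    simp only [_root_.map_pow, rename_X]
  have hTpres : ∀ p : MvPolynomial τ ℂ, (∀ i, degreeOf i p ≤ β i) → IsUpperHalfPlaneStable p →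
      IsUpperHalfPlaneStable (T p) ∨ T p = 0 :=
    (BorceaBranden_stabilityPreserver_iff' β T).2 (Or.inr (by rw [hTsymb]; exact hf))
  have hTdeg : ∀ p : MvPolynomial τ ℂ, ∀ i, degreeOf i (T p) ≤ κ i := fun p i =>
    degreeOf_mvOpOf_le (fun α hα j => by rw [degreeOf_prod_X_pow]; exact mem_box_iff.1 hα j) p i
  -- `ST` preserves stability on `ℂ_β[z]`
  have hST : ∀ p : MvPolynomial τ ℂ, (∀ i, degreeOf i p ≤ β i) → IsUpperHalfPlaneStable p →
      IsUpperHalfPlaneStable ((mvSlotOp κ Q ∘ₗ T) p) ∨ (mvSlotOp κ Q ∘ₗ T) p = 0 := by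
    intro p hp hs
    rw [LinearMap.comp_apply]
    rcases hTpres p hp hs with h | h
    · exact hS _ (hTdeg p) h
    · exact Or.inr (by rw [h, map_zero])
  -- the symbol of `ST` is `h`
  have hSTsymb : boundedDegreeSymbol β (mvSlotOp κ Q ∘ₗ T) = mvComposition κ P Q := by
    rw [hT, comp_mvOpOf, symbol_mvOpOf hP, mvComposition]
    refine sum_congr rfl fun α hα => ?_
    rw [mvSlotOp_prod_X_pow Q (mem_box_iff.1 hα)]
  -- Theorem 1.1 (every `κ`) for `ST`
  rcases (BorceaBranden_stabilityPreserver_iff' β (mvSlotOp κ Q ∘ₗ T)).1 hST with ⟨a, A, hA, haA⟩ | hG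
  · right
    refine ⟨A, ∑ m ∈ Fintype.piFinset (fun i => range (β i + 1)),
      ((∏ i, (((β i).choose (m i) : ℕ) : ℂ)) * a (∏ i, X i ^ m i)) • ∏ i, (X i : MvPolynomial τ ℂ) ^ (β i - m i),
      hA, ?_⟩
    rw [← hSTsymb]
    exact boundedDegreeSymbol_of_rankOne fun m hm =>
      haA _ fun i => by rw [degreeOf_prod_X_pow]; exact mem_box_iff.1 hm i
  · left
    rwa [hSTsymb] at hG

/-- **The master composition theorem (Borcea–Brändén II, Cor. 3.4 (a)) for `H_θ = ℋ`, every number of variables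
and every `κ ∈ ℕⁿ`.** If `f(z,w) = Σ_{α≤κ} binom(κ,α) P_α(w) z^α` and `g(z,w) = Σ_{α≤κ} binom(κ,α) Q_α(z) w^α` are
stable, then `h(z,w) = Σ_{α≤κ} binom(κ,α) P_α(w) Q_{κ-α}(z)` is stable or identically zero. Same proof as the tree's
`mv_master_composition` (`κ_i ≥ 1`), run on `mv_master_composition_pass'`. [cite: BorceaBranden2009II, §3 Cor. 3.4
(a) and its proof; Thm. 3.3 (a) for the alternative "or identically zero"] -/
theorem mv_master_composition' {κ : τ → ℕ} (P Q : (τ → ℕ) → MvPolynomial τ ℂ)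
    (hf : IsUpperHalfPlaneStable (mvCompositionF κ P)) (hg : IsUpperHalfPlaneStable (mvCompositionG κ Q)) :
    mvComposition κ P Q = 0 ∨ IsUpperHalfPlaneStable (mvComposition κ P Q) := by
  -- the data with `z ↔ w`, `f ↔ g`
  have hf' : IsUpperHalfPlaneStable (mvCompositionF κ Q) := by
    rw [← rename_swap_mvCompositionG]
    exact isUpperHalfPlaneStable_rename_fiberMap Sum.swap hg
  have hg' : IsUpperHalfPlaneStable (mvCompositionG κ P) := by
    rw [← rename_swap_mvCompositionF]
    exact isUpperHalfPlaneStable_rename_fiberMap Sum.swap hf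
  rcases mv_master_composition_pass' P Q hf hg with h1 | ⟨A, B, hA, hAB⟩
  · exact Or.inr h1
  rcases mv_master_composition_pass' Q P hf' hg' with h2 | ⟨A', B', hA', hAB'⟩
  · refine Or.inr ?_
    rw [← rename_swap_mvComposition] at h2
    have h3 := isUpperHalfPlaneStable_rename_fiberMap Sum.swap h2
    rwa [rename_rename, Sum.swap_swap_eq, rename_id] at h3
  -- both passes give product forms: `A(z)B(w) = B'(z)A'(w)`
  have hsw1 : ∀ q : MvPolynomial τ ℂ,
      rename Sum.swap (rename Sum.inl q) = (rename Sum.inr q : MvPolynomial (τ ⊕ τ) ℂ) := fun q => by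
    rw [rename_rename]
    rfl
  have hsw2 : ∀ q : MvPolynomial τ ℂ,
      rename Sum.swap (rename Sum.inr q) = (rename Sum.inl q : MvPolynomial (τ ⊕ τ) ℂ) := fun q => by
    rw [rename_rename]
    rfl
  have hprod : rename Sum.inl A * rename Sum.inr B =
      (rename Sum.inl B' * rename Sum.inr A' : MvPolynomial (τ ⊕ τ) ℂ) := by
    rw [← hAB, ← rename_swap_mvComposition κ Q P, hAB', _root_.map_mul, hsw1, hsw2, mul_comm]
  by_cases hB : B = 0
  · left
    rw [hAB, hB, map_zero, mul_zero]
  · right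
    -- specialise `z = (i,…,i)`: `A(i) B = B'(i) A'`
    have hAI : eval (fun _ : τ => Complex.I) A ≠ 0 := hA _ fun _ => by simp
    have hspec : C (eval (fun _ : τ => Complex.I) A) * B = C (eval (fun _ : τ => Complex.I) B') * A' := by
      have h := congrArg (MvPolynomial.aeval (Sum.elim (fun _ : τ => (C Complex.I : MvPolynomial τ ℂ)) X)) hprod
      simp only [_root_.map_mul, aeval_rename, Sum.elim_comp_inl, Sum.elim_comp_inr, aeval_X_left_apply] at h
      rwa [aeval_const_C', aeval_const_C'] at h
    have hB'I : eval (fun _ : τ => Complex.I) B' ≠ 0 := by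
      intro h0
      rw [h0, map_zero, zero_mul, mul_eq_zero] at hspec
      rcases hspec with h | h
      · exact hAI (C_eq_zero.1 h)
      · exact hB h
    have hBeq : B = C (eval (fun _ : τ => Complex.I) B' / eval (fun _ : τ => Complex.I) A) * A' := by
      rw [div_eq_mul_inv, mul_comm (eval _ B'), C_mul, mul_assoc, ← hspec, ← mul_assoc, ← C_mul,
        inv_mul_cancel₀ hAI, C_1, one_mul]
    have hBs : IsUpperHalfPlaneStable B := fun w hw => by
      rw [hBeq, _root_.map_mul, eval_C]
      exact mul_ne_zero (div_ne_zero hB'I hAI) (hA' w hw)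
    rw [hAB]
    exact (isUpperHalfPlaneStable_rename_fiberMap Sum.inl hA).mul (isUpperHalfPlaneStable_rename_fiberMap Sum.inr hBs)

end AllKappa

/-! ## §2 Corollary 3.4 (b): the inversion `w ↦ -1/w` -/

section PartB

/-- **`g(z,w)` pointwise**: `g(z,w) = Σ_{α≤κ} binom(κ,α) Q_α(z) w^α`. [cite: BorceaBranden2009II, §3 Cor. 3.4
(definition of `g`)] -/
theorem eval_mvCompositionG (κ : τ → ℕ) (Q : (τ → ℕ) → MvPolynomial τ ℂ) (z w : τ → ℂ) :
    eval (Sum.elim z w) (mvCompositionG κ Q) =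
      ∑ α ∈ Fintype.piFinset (fun i => range (κ i + 1)),
        (∏ i, (((κ i).choose (α i) : ℕ) : ℂ)) * (eval z (Q α) * ∏ i, w i ^ α i) := by
  rw [mvCompositionG, map_sum]
  refine sum_congr rfl fun α _ => ?_
  rw [smul_eval, _root_.map_mul, eval_rename, Sum.elim_comp_inl, _root_.map_prod]
  simp only [map_pow, eval_X, Sum.elim_inr]

/-- **The coefficient family of `g̃(z,w) = w^κ g(z,-1/w)`**: `Q̃_α = (-1)^{|κ-α|} Q_{κ-α}`, so that
`g̃ = Σ_{α≤κ} binom(κ,α) Q̃_α(z) w^α` (`eval_mvCompositionG_reflectNeg`). [cite: BorceaBranden2009II, §3 proof of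
Cor. 3.4 ("Parts (b) and (c) follow similarly")] -/
def reflectNeg (κ : τ → ℕ) (Q : (τ → ℕ) → MvPolynomial τ ℂ) : (τ → ℕ) → MvPolynomial τ ℂ :=
  fun α => (-1 : ℂ) ^ (∑ i, (κ i - α i)) • Q (κ - α)

omit [Fintype τ] [DecidableEq τ] in
/-- `w^k (-1/w)^{k-a} = (-1)^{k-a} w^a` for `a ≤ k`, `w ≠ 0`. [folklore] -/
private theorem pow_mul_neg_inv_pow {w : ℂ} (hw : w ≠ 0) {a k : ℕ} (h : a ≤ k) :
    w ^ k * (-w⁻¹) ^ (k - a) = (-1) ^ (k - a) * w ^ a := by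
  obtain ⟨d, rfl⟩ := Nat.exists_eq_add_of_le h
  rw [Nat.add_sub_cancel_left, pow_add, neg_pow, inv_pow, mul_assoc, mul_left_comm (w ^ d),
    mul_inv_cancel₀ (pow_ne_zero _ hw), mul_one]
  exact mul_comm _ _

/-- **`Σ_{α≤κ} binom(κ,α) Q̃_α(z) w^α = w^κ · g(z,-1/w)`** for `w` with nonzero coordinates (reindex `α ↦ κ-α`,
`binom(κ,κ-α) = binom(κ,α)`, `w^κ (-1/w)^{κ-α} = (-1)^{κ-α} w^α`). [cite: BorceaBranden2009II, §3 proof of Cor. 3.4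
("Parts (b) and (c) follow similarly")] -/
theorem eval_mvCompositionG_reflectNeg (κ : τ → ℕ) (Q : (τ → ℕ) → MvPolynomial τ ℂ) (z : τ → ℂ) {w : τ → ℂ}
    (hw : ∀ i, w i ≠ 0) :
    eval (Sum.elim z w) (mvCompositionG κ (reflectNeg κ Q)) =
      (∏ i, w i ^ κ i) * eval (Sum.elim z fun i => -(w i)⁻¹) (mvCompositionG κ Q) := by
  rw [eval_mvCompositionG, eval_mvCompositionG, mul_sum]
  refine sum_nbij' (fun m => κ - m) (fun m => κ - m) (fun m _ => mem_box_iff.2 fun i => Nat.sub_le _ _)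
    (fun m _ => mem_box_iff.2 fun i => Nat.sub_le _ _)
    (fun m hm => funext fun i => ?_) (fun m hm => funext fun i => ?_) fun m hm => ?_
  · simp only [Pi.sub_apply, Nat.sub_sub_self (mem_box_iff.1 hm i)]
  · simp only [Pi.sub_apply, Nat.sub_sub_self (mem_box_iff.1 hm i)]
  · have hm' := mem_box_iff.1 hm
    have hC : (∏ i, (((κ i).choose ((κ - m) i) : ℕ) : ℂ)) = ∏ i, (((κ i).choose (m i) : ℕ) : ℂ) :=
      prod_congr rfl fun i _ => by rw [Pi.sub_apply, Nat.choose_symm (hm' i)]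
    have key : (∏ i, w i ^ κ i) * ∏ i, (-(w i)⁻¹) ^ ((κ - m) i) =
        (-1 : ℂ) ^ (∑ i, (κ i - m i)) * ∏ i, w i ^ m i := by
      rw [← prod_pow_eq_pow_sum, ← prod_mul_distrib, ← prod_mul_distrib]
      exact prod_congr rfl fun i _ => by rw [Pi.sub_apply]; exact pow_mul_neg_inv_pow (hw i) (hm' i)
    simp only [reflectNeg, smul_eval]
    rw [hC]
    linear_combination (-((∏ i, (((κ i).choose (m i) : ℕ) : ℂ)) * eval z (Q (κ - m)))) * key

/-- **`g̃(z,w) = w^κ g(z,-1/w)` is stable when `g` is** (`-1/w ∈ ℋ` for `w ∈ ℋ`, and `w^κ ≠ 0`).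
[cite: BorceaBranden2009II, §3 proof of Cor. 3.4 ("Parts (b) and (c) follow similarly")] -/
theorem isUpperHalfPlaneStable_mvCompositionG_reflectNeg (κ : τ → ℕ) (Q : (τ → ℕ) → MvPolynomial τ ℂ)
    (hg : IsUpperHalfPlaneStable (mvCompositionG κ Q)) :
    IsUpperHalfPlaneStable (mvCompositionG κ (reflectNeg κ Q)) := by
  intro zw hzw
  have hw0 : ∀ i, (zw ∘ Sum.inr) i ≠ 0 := fun i h => by
    have := hzw (Sum.inr i)
    rw [show zw (Sum.inr i) = 0 from h, Complex.zero_im] at this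
    exact lt_irrefl _ this
  rw [← Sum.elim_comp_inl_inr zw, eval_mvCompositionG_reflectNeg κ Q (zw ∘ Sum.inl) hw0]
  refine mul_ne_zero (prod_ne_zero_iff.2 fun i _ => pow_ne_zero _ (hw0 i)) (hg _ ?_)
  rintro (i | i)
  · simpa using hzw (Sum.inl i)
  · simp only [Sum.elim_inr, Complex.neg_im, Complex.inv_im, Function.comp_apply, neg_div, neg_neg]
    exact div_pos (hzw (Sum.inr i)) (Complex.normSq_pos.2 (hw0 i))

/-- **The polynomial of Cor. 3.4 (b)**: `Σ_{α≤κ} (-1)^α binom(κ,α) P_α(w) Q_α(z)` (`(-1)^α = (-1)^{|α|}`).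
[cite: BorceaBranden2009II, §3 Cor. 3.4 (b)] -/
def mvCompositionB (κ : τ → ℕ) (P Q : (τ → ℕ) → MvPolynomial τ ℂ) : MvPolynomial (τ ⊕ τ) ℂ :=
  ∑ α ∈ Fintype.piFinset (fun i => range (κ i + 1)),
    (∏ i, (((κ i).choose (α i) : ℕ) : ℂ)) •
      ((-1 : ℂ) ^ (∑ i, α i) • (rename Sum.inl (Q α) * rename Sum.inr (P α)))

/-- **`h(f, g̃)` is the polynomial of (b)**: `Σ binom(κ,α) P_α(w) Q̃_{κ-α}(z) = Σ (-1)^α binom(κ,α) P_α(w) Q_α(z)`.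
[cite: BorceaBranden2009II, §3 proof of Cor. 3.4 ("Parts (b) and (c) follow similarly")] -/
theorem mvComposition_reflectNeg (κ : τ → ℕ) (P Q : (τ → ℕ) → MvPolynomial τ ℂ) :
    mvComposition κ P (reflectNeg κ Q) = mvCompositionB κ P Q := by
  rw [mvComposition, mvCompositionB]
  refine sum_congr rfl fun α hα => ?_
  have hα' := mem_box_iff.1 hα
  have h1 : κ - (κ - α) = α := funext fun i => by simp only [Pi.sub_apply, Nat.sub_sub_self (hα' i)]
  have h2 : ∑ i, (κ i - (κ - α) i) = ∑ i, α i :=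
    sum_congr rfl fun i _ => by rw [Pi.sub_apply, Nat.sub_sub_self (hα' i)]
  simp only [reflectNeg]
  rw [h2, h1, map_smul, smul_mul_assoc]

/-- **Borcea–Brändén II, Corollary 3.4 (b), for `H_0 = ℋ`, every number of variables and every `κ ∈ ℕⁿ`.** If
`f(z,w) = Σ_{α≤κ} binom(κ,α) P_α(w) z^α` and `g(z,w) = Σ_{α≤κ} binom(κ,α) Q_α(z) w^α` are stable, then
`Σ_{α≤κ} (-1)^α binom(κ,α) P_α(w) Q_α(z)` is stable or identically zero (part (a) applied to `f` and
`g̃ = w^κ g(z,-1/w)`). [cite: BorceaBranden2009II, §3 Cor. 3.4 (b) and its proof ("Parts (b) and (c) follow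
similarly")] -/
theorem mv_master_composition_b {κ : τ → ℕ} (P Q : (τ → ℕ) → MvPolynomial τ ℂ)
    (hf : IsUpperHalfPlaneStable (mvCompositionF κ P)) (hg : IsUpperHalfPlaneStable (mvCompositionG κ Q)) :
    mvCompositionB κ P Q = 0 ∨ IsUpperHalfPlaneStable (mvCompositionB κ P Q) := by
  rw [← mvComposition_reflectNeg]
  exact mv_master_composition' P _ hf (isUpperHalfPlaneStable_mvCompositionG_reflectNeg κ Q hg)

end PartB

end Literature.Combinatorics.StablePolynomials

end
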